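import Mathlib.RingTheory.Filtration
import Mathlib.RingTheory.Ideal.Quotient.Operations
import Mathlib.RingTheory.Ideal.Quotient.Noetherian
import Mathlib.RingTheory.MvPolynomial.Basic
import Mathlib.RingTheory.Polynomial.Basic
import HarnessLib

/-!
# A prime below a point whose tangent conditions span is the point (Nakayama / Krull intersection)

Standard local algebra used to recognise ISOLATED points of fibres from first-order data
(e.g. Hartshorne, *Algebraic Geometry*, I Thm. 5.1 / I Ex. 5.10 (Zariski tangent space and the
Jacobian); Mumford, *The Red Book*, III §4; the implicit-function half of the Jacobian criterion):

* `Ideal.eq_of_le_of_le_sup_sq` — in a noetherian ring, **a prime `p ⊆ m`, `m ≠ ⊤`, with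
  `m ⊆ p + m²` equals `m`**. Proof: in the noetherian domain `R ⧸ p` the image `m̄` satisfies
  `m̄ = m̄²`, hence `m̄ = m̄ⁿ` for all `n ≥ 1`, so `m̄ ⊆ ⋂ₙ m̄ⁿ = 0` by Krull's intersection theorem
  (Mathlib `Ideal.iInf_pow_eq_bot_of_isDomain`), i.e. `m ⊆ p`.
* `MvPolynomial.eq_span_X_sub_C_of_forall_mem_sup_sq` — for a point `a ∈ kⁿ` with maximal ideal
  `𝔪ₐ = (Xᵢ - aᵢ)ᵢ` of `k[X₁, …, Xₙ]` (`k` a field, finitely many variables): **a prime `p ⊆ 𝔪ₐ`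
  such that every `Xᵢ - aᵢ` lies in `p + 𝔪ₐ²` equals `𝔪ₐ`**. In practice the hypothesis is
  witnessed by polynomials `f₁, …, f_N ∈ p` vanishing at `a` whose linear parts at `a` span all
  linear forms (the Jacobian `(∂fⱼ/∂Xᵢ)(a)` has rank `n`): then `Xᵢ - aᵢ ≡ Σⱼ cᵢⱼ fⱼ (mod 𝔪ₐ²)`.
  Geometrically: a closed subvariety `V(p) ∋ a` of `𝔸ⁿ` all of whose defining equations may be
  taken with independent differentials spanning `(kⁿ)^∨` is the reduced point `{a}` near `a` —
  `a` is an isolated point of `V(f₁, …, f_N)`.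

## References

* R. Hartshorne, *Algebraic Geometry* (1977), I §5 (Thm. 5.1, Ex. 5.10). [Hartshorne1977]
* H. Matsumura, *Commutative Ring Theory* (1986), Thm. 8.10 (Krull's intersection theorem).
  [Matsumura1987]
-/

namespace Literature.RingTheory.KrullDimension

open Ideal

/-- **A prime `p ⊆ m ≠ ⊤` with `m ⊆ p + m²` is `m`** (noetherian ring): modulo `p`, `m̄ = m̄²`, so
`m̄ ⊆ ⋂ₙ m̄ⁿ = 0` by Krull's intersection theorem in the noetherian domain `R ⧸ p`.
[cite: Matsumura1987, Thm. 8.10 (Krull's intersection theorem)] -/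
theorem _root_.Ideal.eq_of_le_of_le_sup_sq {R : Type*} [CommRing R] [IsNoetherianRing R]
    {p m : Ideal R} [p.IsPrime] (hm : m ≠ ⊤) (hpm : p ≤ m) (h : m ≤ p ⊔ m ^ 2) : p = m := by
  refine le_antisymm hpm ?_
  -- pass to the noetherian domain `R ⧸ p`
  set mk := Ideal.Quotient.mk p with hmk
  set mb : Ideal (R ⧸ p) := m.map mk with hmb
  have hmb2 : mb ≤ mb ^ 2 := by
    have h1 : mb ≤ (p ⊔ m ^ 2).map mk := Ideal.map_mono h
    rwa [Ideal.map_sup, Ideal.map_quotient_self, bot_sup_eq, Ideal.map_pow] at h1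
  -- hence `mb = mb ^ n` for all `n ≥ 1`
  have hpow : ∀ n : ℕ, mb ≤ mb ^ (n + 1) := by
    intro n
    induction n with
    | zero => simp
    | succ n ih =>
      calc mb ≤ mb ^ 2 := hmb2
        _ = mb * mb := by rw [pow_two]
        _ ≤ mb ^ (n + 1) * mb := Ideal.mul_mono_left ih
        _ = mb ^ (n + 1 + 1) := by rw [← pow_succ]
  have hmbtop : mb ≠ ⊤ := by
    intro htop
    apply hm
    rw [eq_top_iff_one]
    have h1 : (1 : R ⧸ p) ∈ mb := by rw [htop]; trivial
    rw [hmb, Ideal.mem_map_iff_of_surjective mk Ideal.Quotient.mk_surjective] at h1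
    obtain ⟨x, hx, hx1⟩ := h1
    have hx1' : mk (x - 1) = 0 := by rw [map_sub, hx1, map_one, sub_self]
    rw [hmk, Ideal.Quotient.eq_zero_iff_mem] at hx1'
    have : x - (x - 1) ∈ m := sub_mem hx (hpm hx1')
    simpa using this
  haveI : IsNoetherianRing (R ⧸ p) := inferInstance
  have hbot : mb = ⊥ := by
    refine le_bot_iff.mp ?_
    rw [← Ideal.iInf_pow_eq_bot_of_isDomain (I := mb) hmbtop]
    refine le_iInf fun n => ?_
    cases n with
    | zero => simp
    | succ n => exact hpow n
  -- so `m ≤ p`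
  intro x hx
  have hx' : mk x ∈ mb := Ideal.mem_map_of_mem _ hx
  rw [hbot, Ideal.mem_bot, hmk, Ideal.Quotient.eq_zero_iff_mem] at hx'
  exact hx'

/-- **A prime below a rational point of affine space, to first order the whole maximal ideal, is
the point**: for `a : σ → k` (`σ` finite, `k` a field) and `𝔪ₐ = (Xᵢ - aᵢ)ᵢ ⊆ k[Xᵢ : i ∈ σ]`, a
prime `p ⊆ 𝔪ₐ` with `Xᵢ - aᵢ ∈ p + 𝔪ₐ²` for all `i` equals `𝔪ₐ`. (Typical use: `p ∋ f₁, …, f_N` with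
`fⱼ(a) = 0` and Jacobian of rank `|σ|` at `a`; then `V(p) = {a}` near `a`, an isolated point.)
[cite: Hartshorne1977, I Thm. 5.1 and I Ex. 5.10 (Zariski tangent space / Jacobian)] -/
theorem _root_.MvPolynomial.eq_span_X_sub_C_of_forall_mem_sup_sq {k : Type*} [Field k]
    {σ : Type*} [Finite σ] (a : σ → k) {p : Ideal (MvPolynomial σ k)} [p.IsPrime]
    (hp : p ≤ Ideal.span (Set.range fun i => MvPolynomial.X i - MvPolynomial.C (a i)))
    (h : ∀ i, MvPolynomial.X i - MvPolynomial.C (a i) ∈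
      p ⊔ Ideal.span (Set.range fun i => MvPolynomial.X i - MvPolynomial.C (a i)) ^ 2) :
    p = Ideal.span (Set.range fun i => MvPolynomial.X i - MvPolynomial.C (a i)) := by
  classical
  set m : Ideal (MvPolynomial σ k) := Ideal.span (Set.range fun i => MvPolynomial.X i - MvPolynomial.C (a i))
    with hmdef
  haveI : IsNoetherianRing (MvPolynomial σ k) := MvPolynomial.isNoetherianRing
  -- `m ≠ ⊤`: evaluation at `a` kills `m`
  have hmle : m ≤ RingHom.ker (MvPolynomial.eval a) := by
    rw [hmdef, Ideal.span_le]
    rintro _ ⟨i, rfl⟩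
    simp [RingHom.mem_ker]
  have hm : m ≠ ⊤ := by
    intro htop
    have h1 : (1 : MvPolynomial σ k) ∈ RingHom.ker (MvPolynomial.eval a) := hmle (htop ▸ Submodule.mem_top)
    simp [RingHom.mem_ker] at h1
  refine Ideal.eq_of_le_of_le_sup_sq hm hp ?_
  rw [hmdef, Ideal.span_le]
  rintro _ ⟨i, rfl⟩
  exact h i

end Literature.RingTheory.KrullDimension
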